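import Literature.NumberTheory.GaloisRepresentations.IdeleLocalDegreeCyclotomicGrowth
import Literature.NumberTheory.GaloisRepresentations.RestrictedRamificationCapitulationLayer
import Literature.NumberTheory.GaloisRepresentations.RestrictedRamificationOpenSubgroupLayers
import Literature.NumberTheory.GaloisRepresentations.UnramifiedRadicalDescentAbsolute
import Literature.NumberTheory.GaloisRepresentations.IdeleSUnitsRep
import Mathlib.RingTheory.RootsOfUnity.AlgebraicallyClosed
import HarnessLib

/-!
# The two auxiliary layers of NSW's proof of (8.3.11) above a layer `E ⊆ K_S`: a CYCLOTOMIC layer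
# `E₁ = E(ζ_{p^M}) ⊆ K_S` with `p^k · n_v(E) ∣ n_v(E₁)` on a finite set of places, and a CAPITULATING layer `E₂ ⊇ E₁` in `K_S`
# (Neukirch–Schmidt–Wingberg VIII §3, proof of (8.3.11): «the local degrees of `k_S ⊇ k(μ_{p^∞})` are divisible by `p^∞`»,
# «`Cl_S(k_S) = 0`»; Harari Prop. 15.40 (a))

Topic `NumberTheory/GaloisRepresentations`; namespace `Literature.NumberTheory.GaloisRepresentations`.  THEOREMS ONLY (no
definition, no named fact, no `sorry`, no instance).  Lane «PT3-TC» of cell `bsd-eis` (crux `GoodLatticeBDPValue`,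
stmt-BirchSwinnertonDyer-19032; owner bsd-line-x1-p1-w8 g9, ROUTING #4 2026-08-28T23:51Z): the shared layer supplier of the two
LAYER SUPPLY targets (A4-iii) `exists_layerInf_two_eq_nsmul` and (A4-iv) `exists_layerInf_three_eq_zero`, which run the
finite-layer diagram chase of NSW (8.3.11) (iii)/(iv) over a tower `E ≤ E₁ ≤ E₂` of intermediate fields of `K̄/K` inside
`K_S = K̄^{N_S}` with exactly these two properties.

MATHEMATICS.  `K` a number field, `S ⊇ S_p` a set of finite places (`hSp`), `N_S ≤ Γ_K` the ramification subgroup,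
`F₀ ≤ E ⊆ K̄` with `E/K` finite Galois and `N_S ≤ Gal(K̄/E)` (`E ⊆ K_S`), `S₀` a finite set of finite places of `F₀`
(in the application: the places above `S`), `k : ℕ`.
(1) CYCLOTOMIC LAYER.  By the tree's `IdeleCohomology.exists_forall_pow_mul_localDegree_dvd` (width seat w5 g6: local degrees
grow `p`-divisibly up the cyclotomic tower, Serre II §4.4 Lemme 1) there is `M` such that every finite Galois `E′ ⊇ E` over `F₀`
containing a primitive `p^M`-th root of unity has `p^k · n_v(E/F₀) ∣ n_v(E′/F₀)` for `v ∈ S₀`; `E₁ := E ⊔ K(ζ_{p^M}) ⊆ K̄` is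
finite Galois over `K`, and lies in `K_S` because `N_S` fixes `E` and the `p`-power roots of unity (`S ⊇ S_p`, tree
`smul_eq_self_of_mem_ramificationSubgroup_of_pow_eq_one`).
(2) CAPITULATING LAYER.  The tree's `exists_capitulationLayer` (width seat w6 g8: a copy of the Hilbert class field of `E₁`
inside `K̄` lies in `K_S` and capitulates every idèle of `E₁`), re-read with `galFixing` and in the `⊔`-membership shape
`con_{E₂/E₁}(x) ∈ E₂ˣ · J_{E₂,S₀}` used by the chase.

* §0 `le_galFixing_iff_le_fixingSubgroup` (the two spellings of «`⊆ K_S`» agree), `exists_finset_mem_iff_under_mem`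
  (the places of a finite extension above a finite `S` form a `Finset`).
* §1 **`exists_cyclotomicLayer`**, §2 **`exists_capitulationLayer_sup_ideleS`**, §3 the package **`exists_cycCapLayers`**.

All inclusion algebras are `OpenSubgroupLayer.algOfLE` (ruling (α) of the lane), supplied inside the statements by `letI`.
HONEST FRAMING: field-theoretic plumbing over landed theorems; no statement of any Summit, no Poitou–Tate theorem, no case
of BSD is proved here.

## References
* J. Neukirch, A. Schmidt, K. Wingberg, *Cohomology of Number Fields*, 2nd ed. (2008), VIII §3, proof of (8.3.11).
  [NeukirchSchmidtWingberg2008]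
* D. Harari, *Galois Cohomology and Class Field Theory*, Universitext, Springer (2020), Prop. 15.40 (a), Thm. 15.31 (principal
  ideal theorem). [Harari2020]
* J.-P. Serre, *Cohomologie galoisienne* (1997), II §4.4 Lemme 1. [SerreGaloisCohomology1997]
-/

noncomputable section

open NumberField IsDedekindDomain Field IntermediateField
open Literature.NumberTheory.GaloisRepresentations.OpenSubgroupLayer (algOfLE isScalarTower_algOfLE)
open Literature.NumberTheory.GaloisRepresentations.LocalWeilDatum

namespace Literature.NumberTheory.GaloisRepresentations

variable {K : Type} [Field K] [NumberField K] (S : Set (HeightOneSpectrum (𝓞 K)))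

/-! ## §0. Two spellings of `⊆ K_S`; the places above a finite `S` -/

omit [NumberField K] in
/-- `N ≤ galFixing K E ↔ N ≤ E.fixingSubgroup` (the tree's `galFixing` is Mathlib's `fixingSubgroup` transported along the
identity `absoluteGaloisGroup.toAlgEquiv`). [cite: NeukirchSchmidtWingberg2008, VIII §3 (`K_S = K̄^{N_S}`)] -/
theorem le_galFixing_iff_le_fixingSubgroup (N : Subgroup (absoluteGaloisGroup K))
    (E : IntermediateField K (AlgebraicClosure K)) : N ≤ galFixing K E ↔ N ≤ E.fixingSubgroup :=
  Iff.rfl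

/-- **The places of a number field `F₀ ⊇ K` above a finite set `S` of places of `K` form a finite set** (as a `Finset`
with its membership characterisation). [cite: CasselsFrohlichANT1967, Ch. VII §7.3 (finitely many `w ∣ v`)] -/
theorem exists_finset_mem_iff_under_mem (hfin : S.Finite) (F₀ : Type) [Field F₀] [NumberField F₀] [Algebra K F₀] :
    ∃ S₀ : Finset (HeightOneSpectrum (𝓞 F₀)), ∀ u : HeightOneSpectrum (𝓞 F₀), u ∈ S₀ ↔ u.under (𝓞 K) ∈ S := by
  classical
  have h : {u : HeightOneSpectrum (𝓞 F₀) | u.under (𝓞 K) ∈ hfin.toFinset}.Finite :=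
    IdeleCohomology.finite_setOf_under_mem (F := K) (E := F₀) (S := hfin.toFinset)
  refine ⟨h.toFinset, fun u => ?_⟩
  rw [Set.Finite.mem_toFinset, Set.mem_setOf_eq, Set.Finite.mem_toFinset]

/-! ## §1. The cyclotomic layer `E₁ = E(ζ_{p^M}) ⊆ K_S` with `p^k · n_v(E) ∣ n_v(E₁)` -/

variable (p : ℕ) [hp : Fact p.Prime]

/-- **The cyclotomic layer.**  For `S ⊇ S_p`, `F₀ ≤ E ⊆ K̄` with `E/K` finite Galois inside `K_S`, a finite set `S₀` of finite
places of `F₀` and `k`, there is a finite Galois `E₁ ⊇ E` over `K` inside `K_S` with `p ^ k * n_v(E/F₀) ∣ n_v(E₁/F₀)` for every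
`v ∈ S₀` — namely `E₁ = E(ζ_{p^M})` for `M ≫ 0` (NSW: «the local degrees of `k_S ⊇ k(μ_{p^∞})` at the primes of `S` are divisible
by `p^∞`»). The inclusion algebras `F₀ → E`, `F₀ → E₁` are supplied inside.
[cite: NeukirchSchmidtWingberg2008, VIII §3 (8.3.11) (proof)][cite: SerreGaloisCohomology1997, II §4.4 Lemme 1] -/
theorem exists_cyclotomicLayer (hSp : ∀ v : HeightOneSpectrum (𝓞 K), ((p : ℕ) : 𝓞 K) ∈ v.asIdeal → v ∈ S)
    {F₀ E : IntermediateField K (AlgebraicClosure K)} [FiniteDimensional K E] [IsGalois K E] (hF : F₀ ≤ E)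
    (hS : ramificationSubgroup K S ≤ galFixing K E) (S₀ : Finset (HeightOneSpectrum (𝓞 F₀))) (k : ℕ) :
    ∃ (E₁ : IntermediateField K (AlgebraicClosure K)) (h₁ : E ≤ E₁) (_ : FiniteDimensional K E₁) (_ : IsGalois K E₁),
      ramificationSubgroup K S ≤ galFixing K E₁ ∧
      (letI := algOfLE hF
       letI := algOfLE (hF.trans h₁)
       haveI : FiniteDimensional K F₀ :=
         FiniteDimensional.of_injective (IntermediateField.inclusion hF).toLinearMap
           (IntermediateField.inclusion hF).injective
       haveI : NumberField F₀ := NumberField.of_module_finite K F₀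
       haveI : NumberField E := NumberField.of_module_finite K E
       haveI : NumberField E₁ := NumberField.of_module_finite K E₁
       haveI := isScalarTower_algOfLE (K := K) hF
       haveI := isScalarTower_algOfLE (K := K) (hF.trans h₁)
       haveI : IsGalois F₀ E := IsGalois.tower_top_of_isGalois K F₀ E
       haveI : IsGalois F₀ E₁ := IsGalois.tower_top_of_isGalois K F₀ E₁
       ∀ v ∈ S₀, p ^ k * IdeleCohomology.localDegree E v ∣ IdeleCohomology.localDegree E₁ v) := by
  classical
  -- instances at the layer `E` over `F₀`
  letI := algOfLE hF
  haveI hF₀fin : FiniteDimensional K F₀ :=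
    FiniteDimensional.of_injective (IntermediateField.inclusion hF).toLinearMap (IntermediateField.inclusion hF).injective
  haveI : NumberField F₀ := NumberField.of_module_finite K F₀
  haveI : NumberField E := NumberField.of_module_finite K E
  haveI := isScalarTower_algOfLE (K := K) hF
  haveI : IsGalois F₀ E := IsGalois.tower_top_of_isGalois K F₀ E
  -- the threshold `M` of the cyclotomic growth of the local degrees over `F₀`
  obtain ⟨M, hM⟩ := IdeleCohomology.exists_forall_pow_mul_localDegree_dvd p E S₀ k
  -- a primitive `p^M`-th root of unity `ζ ∈ K̄` and the compositum `E₁ = E ⊔ K(ζ)`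
  haveI : NeZero ((p : ℕ) : K) := ⟨Nat.cast_ne_zero.2 hp.out.ne_zero⟩
  haveI : NeZero (p ^ M) := ⟨pow_ne_zero _ hp.out.ne_zero⟩
  haveI := AlgebraicClosure.hasEnoughRootsOfUnity_pow K p M
  obtain ⟨ζ, hζ⟩ := HasEnoughRootsOfUnity.exists_primitiveRoot (AlgebraicClosure K) (p ^ M)
  let L : IntermediateField K (AlgebraicClosure K) := K⟮ζ⟯
  haveI : FiniteDimensional K L := IntermediateField.adjoin.finiteDimensional (Algebra.IsIntegral.isIntegral ζ)
  haveI : IsCyclotomicExtension {p ^ M} K L := IsPrimitiveRoot.intermediateField_adjoin_isCyclotomicExtension (K := K) hζ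
  haveI : IsGalois K L := IsCyclotomicExtension.isGalois {p ^ M} K L
  let E₁ : IntermediateField K (AlgebraicClosure K) := E ⊔ L
  have h₁ : E ≤ E₁ := le_sup_left
  haveI : FiniteDimensional K E₁ := IntermediateField.finiteDimensional_sup E L
  haveI : IsGalois K E₁ :=
    { to_isSeparable := Algebra.isSeparable_tower_bot_of_isSeparable K E₁ (AlgebraicClosure K) }
  -- `E₁ ⊆ K_S`: `N_S` fixes `E` and `ζ` (`S ⊇ S_p`), hence `K(ζ)` and the compositum
  have hS₁ : ramificationSubgroup K S ≤ galFixing K E₁ := by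
    change ramificationSubgroup K S ≤ galFixing K (E ⊔ L)
    rw [galFixing_sup]
    refine le_inf hS fun σ hσ => (mem_galFixing_iff K).2 fun y hy => ?_
    exact smul_eq_self_of_mem_adjoin K (S := {ζ})
      (fun z hz => by
        rw [Set.mem_singleton_iff.1 hz]
        exact smul_eq_self_of_mem_ramificationSubgroup_of_pow_eq_one K (p := p) hSp hζ.pow_eq_one hσ) hy
  refine ⟨E₁, h₁, inferInstance, inferInstance, hS₁, ?_⟩
  -- the local degrees: `E₁ ∋ ζ` is finite Galois over `F₀` above `E`
  letI := algOfLE (hF.trans h₁)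
  letI := algOfLE h₁
  haveI : NumberField E₁ := NumberField.of_module_finite K E₁
  haveI := isScalarTower_algOfLE (K := K) (hF.trans h₁)
  haveI : IsScalarTower F₀ E E₁ := IsScalarTower.of_algebraMap_eq fun _ => rfl
  haveI : IsGalois F₀ E₁ := IsGalois.tower_top_of_isGalois K F₀ E₁
  intro v hv
  let ζ₁ : E₁ := ⟨ζ, le_sup_right (b := L) (mem_adjoin_simple_self K ζ)⟩
  have hζ₁ : IsPrimitiveRoot ζ₁ (p ^ M) := IsPrimitiveRoot.coe_submonoidClass_iff.1 hζ
  exact hM M le_rfl E₁ ζ₁ hζ₁ v hv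

/-! ## §2. The capitulating layer `E₂ ⊇ E₁` inside `K_S` -/

omit hp in
/-- **The capitulating layer, `⊔`-membership form.**  For `F₀ ≤ E₁ ⊆ K̄` with `E₁/K` finite Galois inside `K_S` and a finite
set `S₀` of finite places of `F₀`, there is a finite Galois `E₂ ⊇ E₁` over `K` inside `K_S` such that the base change of every
idèle of `E₁` lies in `E₂ˣ · J_{E₂,S₀}` (the tree's `exists_capitulationLayer` — a copy of the Hilbert class field of `E₁` in `K̄`
— read with `galFixing` and `Subgroup` suprema). The inclusion algebras are supplied inside.
[cite: NeukirchSchmidtWingberg2008, VIII §3 (8.3.11) (proof: `Cl_S(k_S) = 0`)][cite: Harari2020, Prop. 15.40 (a), Thm. 15.31] -/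
theorem exists_capitulationLayer_sup_ideleS {F₀ E₁ : IntermediateField K (AlgebraicClosure K)} [FiniteDimensional K E₁]
    [IsGalois K E₁] (hF : F₀ ≤ E₁) (hS : ramificationSubgroup K S ≤ galFixing K E₁)
    (S₀ : Finset (HeightOneSpectrum (𝓞 F₀))) :
    ∃ (E₂ : IntermediateField K (AlgebraicClosure K)) (h₂ : E₁ ≤ E₂) (_ : FiniteDimensional K E₂) (_ : IsGalois K E₂),
      ramificationSubgroup K S ≤ galFixing K E₂ ∧
      (letI := algOfLE h₂
       letI := algOfLE (hF.trans h₂)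
       haveI : NumberField E₁ := NumberField.of_module_finite K E₁
       haveI : NumberField E₂ := NumberField.of_module_finite K E₂
       ∀ x : ideleGroup E₁,
         Literature.NumberTheory.Automorphic.AdeleRing.ideleBaseChange E₁ E₂ x ∈
           principalIdeles E₂ ⊔ IdeleCohomology.ideleS F₀ E₂ S₀) := by
  obtain ⟨M, h, hfin, hgal, hM, -, hcap⟩ :=
    exists_capitulationLayer (S := S) E₁ ((le_galFixing_iff_le_fixingSubgroup _ _).1 hS)
  refine ⟨M, h, hfin, hgal, (le_galFixing_iff_le_fixingSubgroup _ _).2 hM, ?_⟩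
  letI := algOfLE h
  letI := algOfLE (hF.trans h)
  haveI : NumberField E₁ := NumberField.of_module_finite K E₁
  haveI : NumberField M := NumberField.of_module_finite K M
  haveI : FiniteDimensional K F₀ :=
    FiniteDimensional.of_injective (IntermediateField.inclusion (hF.trans h)).toLinearMap
      (IntermediateField.inclusion (hF.trans h)).injective
  haveI : NumberField F₀ := NumberField.of_module_finite K F₀
  intro x
  obtain ⟨u, j, hj, hx⟩ := hcap F₀ S₀ x
  rw [hx]
  exact Subgroup.mul_mem_sup ⟨u, rfl⟩ hj

/-! ## §3. Both layers at once -/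

/-- **The tower `E ≤ E₁ ≤ E₂` inside `K_S` of NSW's proof of (8.3.11)**: over a layer `E` (finite Galois over `K`, `⊆ K_S`,
`F₀ ≤ E`), a finite Galois `E₁ ⊇ E` in `K_S` with `p ^ k * n_v(E/F₀) ∣ n_v(E₁/F₀)` on `S₀`, and a finite Galois `E₂ ⊇ E₁` in
`K_S` in which every idèle of `E₁` becomes principal times an `S₀`-idèle.  The inclusion algebras are supplied inside.
[cite: NeukirchSchmidtWingberg2008, VIII §3 (8.3.11) (proof)][cite: Harari2020, Prop. 15.40 (a)] -/
theorem exists_cycCapLayers (hSp : ∀ v : HeightOneSpectrum (𝓞 K), ((p : ℕ) : 𝓞 K) ∈ v.asIdeal → v ∈ S)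
    {F₀ E : IntermediateField K (AlgebraicClosure K)} [FiniteDimensional K E] [IsGalois K E] (hF : F₀ ≤ E)
    (hS : ramificationSubgroup K S ≤ galFixing K E) (S₀ : Finset (HeightOneSpectrum (𝓞 F₀))) (k : ℕ) :
    ∃ (E₁ : IntermediateField K (AlgebraicClosure K)) (h₁ : E ≤ E₁) (_ : FiniteDimensional K E₁) (_ : IsGalois K E₁)
      (E₂ : IntermediateField K (AlgebraicClosure K)) (h₂ : E₁ ≤ E₂) (_ : FiniteDimensional K E₂) (_ : IsGalois K E₂),
      ramificationSubgroup K S ≤ galFixing K E₁ ∧ ramificationSubgroup K S ≤ galFixing K E₂ ∧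
      (letI := algOfLE hF
       letI := algOfLE (hF.trans h₁)
       haveI : FiniteDimensional K F₀ :=
         FiniteDimensional.of_injective (IntermediateField.inclusion hF).toLinearMap
           (IntermediateField.inclusion hF).injective
       haveI : NumberField F₀ := NumberField.of_module_finite K F₀
       haveI : NumberField E := NumberField.of_module_finite K E
       haveI : NumberField E₁ := NumberField.of_module_finite K E₁
       haveI := isScalarTower_algOfLE (K := K) hF
       haveI := isScalarTower_algOfLE (K := K) (hF.trans h₁)
       haveI : IsGalois F₀ E := IsGalois.tower_top_of_isGalois K F₀ E
       haveI : IsGalois F₀ E₁ := IsGalois.tower_top_of_isGalois K F₀ E₁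
       ∀ v ∈ S₀, p ^ k * IdeleCohomology.localDegree E v ∣ IdeleCohomology.localDegree E₁ v) ∧
      (letI := algOfLE h₂
       letI := algOfLE ((hF.trans h₁).trans h₂)
       haveI : NumberField E₁ := NumberField.of_module_finite K E₁
       haveI : NumberField E₂ := NumberField.of_module_finite K E₂
       ∀ x : ideleGroup E₁,
         Literature.NumberTheory.Automorphic.AdeleRing.ideleBaseChange E₁ E₂ x ∈
           principalIdeles E₂ ⊔ IdeleCohomology.ideleS F₀ E₂ S₀) := by
  obtain ⟨E₁, h₁, hfin₁, hgal₁, hS₁, hdeg⟩ := exists_cyclotomicLayer S p hSp hF hS S₀ k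
  obtain ⟨E₂, h₂, hfin₂, hgal₂, hS₂, hcap⟩ := exists_capitulationLayer_sup_ideleS S (hF.trans h₁) hS₁ S₀
  exact ⟨E₁, h₁, hfin₁, hgal₁, E₂, h₂, hfin₂, hgal₂, hS₁, hS₂, hdeg, hcap⟩

end Literature.NumberTheory.GaloisRepresentations

end
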